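import Summits.Ventures.PercRepro.Night2LocalD3ThreeTwoD

/-!
# PercRepro — the cell `(a, k) = (3, 2)` at `|E ∖ G| = 3`, `q = 4`: the preimages of `S ∖ v` and the candidates' weights (night-2, gen 13)

Sequel of `Night2LocalD3ThreeTwoD.lean`.  With `coloops S = K ∪ {x}` and non-coloops `T = {v, z₁, z₂}`:

* `S ∖ v = coloops S ∪ (T ∖ v)` and `(S ∖ v) ∖ z₁ = insert z₂ (coloops S)` (`erase_erase_eq_insert`);
* the layer-1 preimages of the independent five-set `S ∖ v` are `(S ∖ v) ∖ x` (request `≤ req(S ∖ x)`) and the two candidates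
  `insert z₂ (coloops S)`, `insert z₁ (coloops S)` when they are members — the `K`-deletions are layer-0 — so
  `L₁(S ∖ v) ≤ req(S ∖ x) + r₁ + r₂` for any bounds `rᵢ` of the members' requests (`L1_erase_le_of_three`);
* `w₂(cand w, S) ≤ req(cand w)/(|G ∖ cl(cand w)| − 1) · (λ(L_u) + λ(L_{u'}))`, `λ(L) = (L − 2/5)⁺/L`, for bounds
  `L_u ≥ L₁(S ∖ u)`, `L_{u'} ≥ L₁(S ∖ u')` (`w2_cand_le`).
-/

open scoped Matroid

namespace PercRepro.Shadow

open Finset PerFlat ThmH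

variable {α : Type*} [DecidableEq α] {M : Matroid α} [M.Finite]

section Preimages

variable {G S : Finset α}

/-- A sum over `insert a s` of a nonnegative function is at most `f a` plus the sum over `s`. -/
theorem sum_insert_le_of_nonneg {β : Type*} [DecidableEq β] {s : Finset β} {a : β} {f : β → ℚ}
    (hf : ∀ b, 0 ≤ f b) : ∑ b ∈ insert a s, f b ≤ f a + ∑ b ∈ s, f b := by
  by_cases ha : a ∈ s
  · rw [Finset.insert_eq_of_mem ha]
    linarith [hf a]
  · rw [Finset.sum_insert ha]

/-- `S ∖ v = coloops S ∪ (T ∖ v)` for a non-coloop `v`. -/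
theorem erase_eq_coloops_union {v : α} (hv : v ∈ nonColoops M S) :
    S.erase v = coloops M S ∪ (nonColoops M S).erase v := by
  ext e
  rw [Finset.mem_erase, Finset.mem_union, Finset.mem_erase, mem_nonColoops]
  constructor
  · rintro ⟨hev, heS⟩
    by_cases hec : e ∈ coloops M S
    · exact Or.inl hec
    · exact Or.inr ⟨hev, heS, hec⟩
  · rintro (hec | ⟨hev, heS, -⟩)
    · refine ⟨?_, coloops_subset_self S hec⟩
      rintro rfl
      exact (mem_nonColoops.1 hv).2 hec
    · exact ⟨hev, heS⟩

/-- With `T = {v, z₁, z₂}`, `(S ∖ v) ∖ z₁ = insert z₂ (coloops S)`. -/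
theorem erase_erase_eq_insert {v z₁ z₂ : α} (hT : nonColoops M S = {v, z₁, z₂}) (hv1 : v ≠ z₁) (hv2 : v ≠ z₂)
    (h12 : z₁ ≠ z₂) : (S.erase v).erase z₁ = insert z₂ (coloops M S) := by
  have hv : v ∈ nonColoops M S := by rw [hT]; exact Finset.mem_insert_self _ _
  rw [erase_eq_coloops_union hv, hT]
  ext e
  simp only [Finset.mem_erase, Finset.mem_union, Finset.mem_insert, Finset.mem_singleton]
  constructor
  · rintro ⟨he1, hec | ⟨hev, rfl | rfl | rfl⟩⟩
    · exact Or.inr hec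
    · exact absurd rfl hev
    · exact absurd rfl he1
    · exact Or.inl rfl
  · rintro (rfl | hec)
    · exact ⟨h12.symm, Or.inr ⟨hv2.symm, Or.inr (Or.inr rfl)⟩⟩
    · refine ⟨?_, Or.inl hec⟩
      rintro rfl
      have : e ∈ nonColoops M S := by rw [hT]; exact Finset.mem_insert_of_mem (Finset.mem_insert_self _ _)
      exact (mem_nonColoops.1 this).2 hec

open scoped Classical in
/-- **The layer-1 request at `S ∖ v`**: with `T = {v, z₁, z₂}` and `coloops S = K ∪ {x}`, the layer-1 preimages of the
independent five-set `S ∖ v` are `(S ∖ v) ∖ x` (request `≤ req(S ∖ x)`) and the candidates `insert z₂ (coloops S)`,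
`insert z₁ (coloops S)` when they are members; the `K`-deletions are layer-0. -/
theorem L1_erase_le_of_three (hG : G ∈ flatsQ M (4 + 1)) (hd : (gr M \ G).card = 3)
    (hS : S ∈ shadowAt M (4 + 2) 4 (Uq M (4 + 2) 4) G) (hS6 : S.card = 6) {x : α}
    (hxK : x ∉ G.filter (fun y => y ∉ clF M (G.erase y)))
    (hcol : coloops M S = insert x (G.filter (fun y => y ∉ clF M (G.erase y)))) {v z₁ z₂ : α}
    (hT : nonColoops M S = {v, z₁, z₂}) (hv1 : v ≠ z₁) (hv2 : v ≠ z₂) (h12 : z₁ ≠ z₂) {r₁ r₂ : ℚ}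
    (hr₁ : insert z₁ (coloops M S) ∈ membersIn M (Uq M (4 + 2) 4) G → req M 4 (insert z₁ (coloops M S)) ≤ r₁)
    (hr₂ : insert z₂ (coloops M S) ∈ membersIn M (Uq M (4 + 2) 4) G → req M 4 (insert z₂ (coloops M S)) ≤ r₂)
    (hr₁0 : 0 ≤ r₁) (hr₂0 : 0 ≤ r₂) :
    L1 M 4 G (S.erase v) ≤ req M 4 (S.erase x) + r₁ + r₂ := by
  set K := G.filter (fun y => y ∉ clF M (G.erase y)) with hKdef
  have hGg : G ⊆ gr M := (mem_flatsQ.1 hG).1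
  have hSG : S ⊆ G := subset_of_mem_shadowAt hS
  have hv : v ∈ nonColoops M S := by rw [hT]; exact Finset.mem_insert_self _ _
  have hz₁ : z₁ ∈ nonColoops M S := by rw [hT]; exact Finset.mem_insert_of_mem (Finset.mem_insert_self _ _)
  have hz₂ : z₂ ∈ nonColoops M S := by
    rw [hT]; exact Finset.mem_insert_of_mem (Finset.mem_insert_of_mem (Finset.mem_singleton_self _))
  have hI : M.Indep ((S.erase v : Finset α) : Set α) := indep_erase_of_mem_nonColoops hG hS hS6 hv
  have hxcol : x ∈ coloops M S := by rw [hcol]; exact Finset.mem_insert_self x _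
  have hxS : x ∈ S := coloops_subset_self S hxcol
  have hxv : x ≠ v := fun h => (mem_nonColoops.1 hv).2 (h ▸ hxcol)
  have hxe : x ∈ gr M \ clF M (S.erase x) := Finset.mem_sdiff.2 ⟨hGg (hSG hxS), (mem_coloops.1 hxcol).2⟩
  -- the preimage set lies in the three-element family `U`
  set U : Finset (Finset α) := {(S.erase v).erase x, insert z₂ (coloops M S), insert z₁ (coloops M S)} with hUdef
  set F := (coverPreimages M (Uq M (4 + 2) 4) G (S.erase v)).filter (fun B => B ∉ lay0 M 4 G) with hFdef
  have hFU : F ⊆ U := by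
    intro B' hB'
    rw [hFdef, Finset.mem_filter, mem_coverPreimages, mem_coverSets] at hB'
    obtain ⟨⟨hB'm, z, hz, hzS⟩, hB'0⟩ := hB'
    have hB'U : B' ∈ Uq M (4 + 2) 4 := (mem_membersIn.1 hB'm).1
    have hzB' : z ∉ B' := fun h => (Finset.mem_sdiff.1 hz).2 (subset_clF hB'U h)
    have hB'eq : B' = (S.erase v).erase z := by rw [← hzS, Finset.erase_insert hzB']
    have hzSv : z ∈ S.erase v := by rw [← hzS]; exact Finset.mem_insert_self _ _
    have hzS' : z ∈ S := (Finset.mem_erase.1 hzSv).2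
    have hzv : z ≠ v := (Finset.mem_erase.1 hzSv).1
    -- `z ∉ K`: a `K`-deletion is layer-0
    have hzK : z ∉ K := by
      intro hzK
      apply hB'0
      rw [mem_lay0]
      refine ⟨hB'm, ?_, by omega⟩
      have hzG : z ∈ G := (Finset.mem_filter.1 hzK).1
      have hzcl : z ∉ clF M (G.erase z) := (Finset.mem_filter.1 hzK).2
      have hzcolG : z ∈ coloops M G := Finset.mem_filter.2 ⟨hzG, hzcl⟩
      have hrGz : rkN M (G.erase z) = 4 := by
        have := rkN_erase_of_mem_coloops hGg hzcolG
        have hGr : rkN M G = 4 + 1 := by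
          have h := (mem_flatsQ.1 hG).2.2
          rw [eRk_eq_rkN] at h
          exact_mod_cast h
        omega
      have hrB' : rkN M B' = 4 := by
        have h := (mem_Uq.1 hB'U).2.1
        rw [eRk_eq_rkN] at h
        exact_mod_cast h
      have hB'sub : B' ⊆ G.erase z := by
        rw [hB'eq]
        exact Finset.erase_subset_erase z ((Finset.erase_subset v S).trans hSG)
      have hGz : G.erase z ⊆ clF M B' := by
        have h := subset_closure_of_rkN_eq ((Finset.erase_subset z G).trans hGg) hB'sub (by omega)
        intro e he
        rw [← Finset.mem_coe, coe_clF]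
        exact h (by exact_mod_cast he)
      have hGsub : G \ clF M B' ⊆ {z} := by
        intro e he
        rw [Finset.mem_sdiff] at he
        rw [Finset.mem_singleton]
        by_contra hne
        exact he.2 (hGz (Finset.mem_erase.2 ⟨hne, he.1⟩))
      have h1 : (G \ clF M B').card ≤ 1 := (Finset.card_le_card hGsub).trans (by simp)
      have h2 : 1 ≤ (G \ clF M B').card := Finset.card_pos.2 ⟨z, hz⟩
      omega
    rw [hUdef, Finset.mem_insert, Finset.mem_insert, Finset.mem_singleton, hB'eq]
    rcases mem_coloops_or_mem_nonColoops (M := M) hzS' with hzc | hzn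
    · rw [hcol, Finset.mem_insert] at hzc
      rcases hzc with rfl | hzc
      · exact Or.inl rfl
      · exact absurd hzc hzK
    · rw [hT, Finset.mem_insert, Finset.mem_insert, Finset.mem_singleton] at hzn
      rcases hzn with rfl | rfl | rfl
      · exact absurd rfl hzv
      · exact Or.inr (Or.inl (erase_erase_eq_insert hT hv1 hv2 h12))
      · right; right
        have hT' : nonColoops M S = {v, z, z₁} := by rw [hT, Finset.pair_comm z₁ z]
        exact erase_erase_eq_insert hT' hv2 hv1 h12.symm
  -- bound the sum
  have hmem : ∀ B ∈ F, B ∈ membersIn M (Uq M (4 + 2) 4) G := by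
    intro B hB
    rw [hFdef, Finset.mem_filter, mem_coverPreimages] at hB
    exact hB.1.1
  have hsum : L1 M 4 G (S.erase v) = ∑ B ∈ U, (if B ∈ F then req M 4 B else 0) := by
    unfold L1
    rw [Finset.sum_ite_mem, Finset.inter_eq_right.2 hFU]
  rw [hsum, hUdef]
  have hnn : ∀ B, 0 ≤ (if B ∈ F then req M 4 B else 0) := by
    intro B; split_ifs
    · exact req_nonneg 4 B
    · exact le_refl _
  have h1 : (if (S.erase v).erase x ∈ F then req M 4 ((S.erase v).erase x) else 0) ≤ req M 4 (S.erase x) := by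
    split_ifs with h
    · exact req_le_req_of_subset (Finset.erase_subset_erase x (Finset.erase_subset v S)) hxe
    · exact req_nonneg 4 _
  have h2 : (if insert z₂ (coloops M S) ∈ F then req M 4 (insert z₂ (coloops M S)) else 0) ≤ r₂ := by
    split_ifs with h
    · exact hr₂ (hmem _ h)
    · exact hr₂0
  have h3 : (if insert z₁ (coloops M S) ∈ F then req M 4 (insert z₁ (coloops M S)) else 0) ≤ r₁ := by
    split_ifs with h
    · exact hr₁ (hmem _ h)
    · exact hr₁0
  calc ∑ B ∈ ({(S.erase v).erase x, insert z₂ (coloops M S), insert z₁ (coloops M S)} : Finset (Finset α)),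
        (if B ∈ F then req M 4 B else 0)
      ≤ (if (S.erase v).erase x ∈ F then req M 4 ((S.erase v).erase x) else 0) +
          ∑ B ∈ ({insert z₂ (coloops M S), insert z₁ (coloops M S)} : Finset (Finset α)),
            (if B ∈ F then req M 4 B else 0) := sum_insert_le_of_nonneg hnn
    _ ≤ (if (S.erase v).erase x ∈ F then req M 4 ((S.erase v).erase x) else 0) +
          ((if insert z₂ (coloops M S) ∈ F then req M 4 (insert z₂ (coloops M S)) else 0) +
          ∑ B ∈ ({insert z₁ (coloops M S)} : Finset (Finset α)), (if B ∈ F then req M 4 B else 0)) := by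
        linarith [sum_insert_le_of_nonneg (s := ({insert z₁ (coloops M S)} : Finset (Finset α)))
          (a := insert z₂ (coloops M S)) hnn]
    _ = (if (S.erase v).erase x ∈ F then req M 4 ((S.erase v).erase x) else 0) +
          ((if insert z₂ (coloops M S) ∈ F then req M 4 (insert z₂ (coloops M S)) else 0) +
          (if insert z₁ (coloops M S) ∈ F then req M 4 (insert z₁ (coloops M S)) else 0)) := by
        rw [Finset.sum_singleton]
    _ ≤ req M 4 (S.erase x) + r₁ + r₂ := by linarith

open scoped Classical in
/-- **The layer-2 weight of a candidate**: with `T = {w, u, u'}`, `w₂(cand w, S) ≤ req(cand w)/(|G ∖ cl(cand w)| − 1) ·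
(lam L_u + lam L_{u'})` for any bounds `L₁(S ∖ u) ≤ L_u`, `L₁(S ∖ u') ≤ L_{u'}`. -/
theorem w2_cand_le (hd : (gr M \ G).card = 3) (hk : kColoops M G = 2)
    (hS : S ∈ shadowAt M (4 + 2) 4 (Uq M (4 + 2) 4) G) {w u u' : α} (hT : nonColoops M S = {w, u, u'})
    (hwu : w ≠ u) (hwu' : w ≠ u') (huu' : u ≠ u') (hB : insert w (coloops M S) ∈ ex2 M 4 G S) {Lu Lu' : ℚ}
    (hLu : L1 M 4 G (S.erase u) ≤ Lu) (hLu' : L1 M 4 G (S.erase u') ≤ Lu') :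
    w2 M 4 G (insert w (coloops M S)) S ≤
      req M 4 (insert w (coloops M S)) / (((G \ clF M (insert w (coloops M S))).card : ℚ) - 1) *
        ((if Lu ≤ 2 / 5 then (0 : ℚ) else (Lu - 2 / 5) / Lu) + (if Lu' ≤ 2 / 5 then (0 : ℚ) else (Lu' - 2 / 5) / Lu')) := by
  have hSG : S ⊆ G := subset_of_mem_shadowAt hS
  obtain ⟨-, hB0, hBS, hsub, hcard⟩ := mem_ex2_unpack hB
  set B := insert w (coloops M S) with hBdef
  have hw : w ∈ nonColoops M S := by rw [hT]; exact Finset.mem_insert_self _ _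
  have hu : u ∈ nonColoops M S := by rw [hT]; exact Finset.mem_insert_of_mem (Finset.mem_insert_self _ _)
  have hu' : u' ∈ nonColoops M S := by
    rw [hT]; exact Finset.mem_insert_of_mem (Finset.mem_insert_of_mem (Finset.mem_singleton_self _))
  -- `S ∖ B = {u, u'}`
  have hSB : S \ B = {u, u'} := by
    ext e
    rw [Finset.mem_sdiff, hBdef, Finset.mem_insert, Finset.mem_insert, Finset.mem_singleton]
    constructor
    · rintro ⟨heS, hnot⟩
      rw [not_or] at hnot
      have : e ∈ nonColoops M S := mem_nonColoops.2 ⟨heS, hnot.2⟩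
      rw [hT, Finset.mem_insert, Finset.mem_insert, Finset.mem_singleton] at this
      rcases this with rfl | rfl | rfl
      · exact absurd rfl hnot.1
      · exact Or.inl rfl
      · exact Or.inr rfl
    · rintro (rfl | rfl)
      · exact ⟨(mem_nonColoops.1 hu).1, by rintro (h | h); exact hwu h.symm; exact (mem_nonColoops.1 hu).2 h⟩
      · exact ⟨(mem_nonColoops.1 hu').1, by rintro (h | h); exact hwu' h.symm; exact (mem_nonColoops.1 hu').2 h⟩
  -- the covering sets `B ∪ {u} = S ∖ u'` and `B ∪ {u'} = S ∖ u`
  have hcov1 : insert u B = S.erase u' := by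
    have hT' : nonColoops M S = {u', u, w} := by
      rw [hT, Finset.pair_comm u u', Finset.insert_comm w u', Finset.pair_comm w u]
    rw [hBdef, ← erase_erase_eq_insert hT' huu'.symm hwu'.symm hwu.symm]
    rw [Finset.insert_erase]
    rw [Finset.mem_erase]
    exact ⟨huu', (mem_nonColoops.1 hu).1⟩
  have hcov2 : insert u' B = S.erase u := by
    have hT' : nonColoops M S = {u, u', w} := by
      rw [hT, Finset.insert_comm w u, Finset.pair_comm w u']
    rw [hBdef, ← erase_erase_eq_insert hT' huu' hwu.symm hwu'.symm]
    rw [Finset.insert_erase]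
    rw [Finset.mem_erase]
    exact ⟨huu'.symm, (mem_nonColoops.1 hu').1⟩
  have hl1 : loss M 4 G B u ≤ req M 4 B * (if Lu' ≤ 2 / 5 then (0 : ℚ) else (Lu' - 2 / 5) / Lu') := by
    apply loss_le_req_mul_lossFrac
    · rw [hcov1]; exact hLu'
    · rw [hcov1]; exact two_fifths_le_capS hd hk ((Finset.erase_subset _ _).trans hSG)
  have hl2 : loss M 4 G B u' ≤ req M 4 B * (if Lu ≤ 2 / 5 then (0 : ℚ) else (Lu - 2 / 5) / Lu) := by
    apply loss_le_req_mul_lossFrac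
    · rw [hcov2]; exact hLu
    · rw [hcov2]; exact two_fifths_le_capS hd hk ((Finset.erase_subset _ _).trans hSG)
  have hm : 2 ≤ (G \ clF M B).card := hcard ▸ Finset.card_le_card hsub
  have hden : (1 : ℚ) ≤ ((G \ clF M B).card : ℚ) - 1 := by
    have : (2 : ℚ) ≤ ((G \ clF M B).card : ℚ) := by exact_mod_cast hm
    linarith
  unfold w2
  rw [if_pos ⟨hB0, hBS, hsub, hcard⟩, hSB, Finset.sum_pair huu', div_mul_eq_mul_div]
  apply div_le_div_of_nonneg_right _ (by linarith)
  rw [mul_add]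
  linarith

end Preimages

end PercRepro.Shadow
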